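import Mathlib.NumberTheory.NumberField.Units.DirichletTheorem
import Mathlib.RingTheory.DedekindDomain.AdicValuation
import Literature.AnabelianGeometry.AbsoluteAnabelian.AbsTopIII.KummerFaithful
import HarnessLib

/-!
# [AbsTopIII] Remark 1.5.3 (i) — DISCHARGE of `Rmk_1_5_3_i` (number fields are torally Kummer-faithful)

Proof-only companion of `AbsTopIII/KummerFaithful.lean` (abc-iut-L4-t1, p404026; never edited
here).  S. Mochizuki, *Topics in Absolute Anabelian Geometry III*, Rmk. 1.5.3 (i), kurims
manuscript p. 33 (lit key `paper:url-5493eb38cbb7`) [cite: MochizukiAbsTopIII2015, Rmk 1.5.3 (i) p.33]: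
"`k` is torally Kummer-faithful … it suffices to show that `⋂_N (k^×)^N = {1}`".  The tree types
the number-field case as the named fact `Rmk_1_5_3_i : ∀ k number field, IsTorallyKummerFaithful k`,
i.e. (by `IsTorallyKummerFaithful`) `char k = 0` and `DivisibleElementsTrivial k'ˣ` for every
finite extension `k'/k`.  This file PROVES it (`Rmk_1_5_3_i_holds`).

## Proof (ours; classical, via Mathlib's Dirichlet unit theorem — the text argues `p`-adically)

For a number field `K` and `x ∈ K^×` with `x ∈ (K^×)^N` for all `N ≥ 1`:
1. every finite valuation of `x` is divisible by every `N` in the value group `ℤ`, hence trivial,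
   so `x` (and, by the same token, each of its roots) is a unit of `𝓞 K`
   (`exists_unit_of_forall_valuation_eq_one`);
2. `(𝓞 K)ˣ ⧸ torsion` is a free `ℤ`-module of finite rank (Mathlib, Dirichlet), and in a free
   `ℤ`-module an element divisible by every `N` is `0` (`eq_zero_of_forall_exists_nsmul`), so `x`
   is a root of unity;
3. a root `w` with `w^N = x`, `N = #μ(K)`, is then torsion as well, so `x = w^{#μ(K)} = 1`.
The finite-extension clause uses `NumberField.of_module_finite`.  Mathlib-only apart from the
statement import; no new definitions, no named facts.
-/

noncomputable section

open scoped Classical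

namespace Literature.AnabelianGeometry.AbsoluteAnabelian.AbsTopIII

universe u

open NumberField NumberField.Units IsDedekindDomain

/-- In a free `ℤ`-module an element divisible by every positive integer is zero (coordinates in a
basis are integers divisible by every positive integer). [cite: MochizukiAbsTopIII2015, Rmk 1.5.3 (i) p.33] -/
theorem eq_zero_of_forall_exists_nsmul {M : Type*} [AddCommGroup M] [Module.Free ℤ M] (m : M)
    (h : ∀ n : ℕ, 0 < n → ∃ m' : M, n • m' = m) : m = 0 := by
  let b := Module.Free.chooseBasis ℤ M
  apply b.repr.injective
  rw [map_zero]
  ext i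
  rw [Finsupp.zero_apply]
  obtain ⟨m', hm'⟩ := h ((b.repr m i).natAbs + 1) (Nat.succ_pos _)
  have hdvd : (((b.repr m i).natAbs + 1 : ℕ) : ℤ) ∣ b.repr m i := by
    refine ⟨b.repr m' i, ?_⟩
    have h1 := congrArg (fun v : M => b.repr v i) hm'
    simp only [map_nsmul, Finsupp.smul_apply, nsmul_eq_mul] at h1
    exact h1.symm
  refine Int.eq_zero_of_dvd_of_natAbs_lt_natAbs hdvd ?_
  rw [Int.natAbs_natCast]
  exact Nat.lt_succ_self _

/-- In the value group `ℤₘ₀`, an element divisible by every positive integer (and nonzero) is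
`1`. [cite: MochizukiAbsTopIII2015, Rmk 1.5.3 (i) p.33] -/
theorem withZeroMulInt_eq_one_of_forall_exists_pow (a : WithZero (Multiplicative ℤ)) (ha : a ≠ 0)
    (h : ∀ n : ℕ, 0 < n → ∃ b : WithZero (Multiplicative ℤ), b ^ n = a) : a = 1 := by
  set m : ℤ := Multiplicative.toAdd (WithZero.unzero ha) with hm
  have hdvd : ∀ n : ℕ, 0 < n → (n : ℤ) ∣ m := by
    intro n hn
    obtain ⟨b, hb⟩ := h n hn
    have hb0 : b ≠ 0 := by
      rintro rfl
      rw [zero_pow hn.ne'] at hb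
      exact ha hb.symm
    refine ⟨Multiplicative.toAdd (WithZero.unzero hb0), ?_⟩
    have h2 : WithZero.unzero ha = WithZero.unzero hb0 ^ n := by
      apply WithZero.coe_inj.mp
      rw [WithZero.coe_unzero, WithZero.coe_pow, WithZero.coe_unzero, hb]
    rw [hm, h2, toAdd_pow, nsmul_eq_mul]
  have hm0 : m = 0 := by
    refine Int.eq_zero_of_dvd_of_natAbs_lt_natAbs (hdvd (m.natAbs + 1) (Nat.succ_pos _)) ?_
    rw [Int.natAbs_natCast]
    exact Nat.lt_succ_self _
  have h1 : WithZero.unzero ha = 1 := by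
    apply Multiplicative.toAdd.injective
    rw [← hm, hm0, toAdd_one]
  rw [← WithZero.coe_unzero ha, h1, WithZero.coe_one]

/-- In `ℤₘ₀`, `b ^ n = 1` with `n > 0` forces `b = 1`. [cite: MochizukiAbsTopIII2015, Rmk 1.5.3 (i) p.33] -/
theorem withZeroMulInt_eq_one_of_pow_eq_one (b : WithZero (Multiplicative ℤ)) {n : ℕ} (hn : 0 < n)
    (h : b ^ n = 1) : b = 1 := by
  have hb0 : b ≠ 0 := by
    rintro rfl
    rw [zero_pow hn.ne'] at h
    exact zero_ne_one h
  have h2 : WithZero.unzero hb0 ^ n = 1 := by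
    apply WithZero.coe_inj.mp
    rw [WithZero.coe_pow, WithZero.coe_unzero, h, WithZero.coe_one]
  have h3 : (n : ℤ) * Multiplicative.toAdd (WithZero.unzero hb0) = 0 := by
    have := congrArg Multiplicative.toAdd h2
    rwa [toAdd_pow, toAdd_one, nsmul_eq_mul] at this
  have h4 : Multiplicative.toAdd (WithZero.unzero hb0) = 0 := by
    rcases mul_eq_zero.mp h3 with h | h
    · exact absurd h (by exact_mod_cast hn.ne')
    · exact h
  have h5 : WithZero.unzero hb0 = 1 := Multiplicative.toAdd.injective (by rw [h4, toAdd_one])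
  rw [← WithZero.coe_unzero hb0, h5, WithZero.coe_one]

variable {K : Type*} [Field K] [NumberField K]

/-- An element of `K^×` all of whose finite valuations equal `1` is (the image of) a unit of
`𝓞 K`. [cite: MochizukiAbsTopIII2015, Rmk 1.5.3 (i) p.33] -/
theorem exists_unit_of_forall_valuation_eq_one (x : Kˣ)
    (h : ∀ v : HeightOneSpectrum (𝓞 K), v.valuation K (x : K) = 1) :
    ∃ u : (𝓞 K)ˣ, algebraMap (𝓞 K) K (u : 𝓞 K) = x := by
  obtain ⟨a, ha⟩ := RingHom.mem_range.mp
    (HeightOneSpectrum.mem_integers_of_valuation_le_one K (x : K) fun v => (h v).le)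
  obtain ⟨b, hb⟩ := RingHom.mem_range.mp
    (HeightOneSpectrum.mem_integers_of_valuation_le_one K ((x⁻¹ : Kˣ) : K) fun v => by
      rw [Units.val_inv_eq_inv_val, map_inv₀, h v, inv_one])
  have hinj : Function.Injective (algebraMap (𝓞 K) K) := IsFractionRing.injective (𝓞 K) K
  refine ⟨⟨a, b, hinj ?_, hinj ?_⟩, ha⟩
  · rw [map_mul, map_one, ha, hb, Units.val_inv_eq_inv_val, mul_inv_cancel₀ x.ne_zero]
  · rw [map_mul, map_one, ha, hb, Units.val_inv_eq_inv_val, inv_mul_cancel₀ x.ne_zero]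

/-- `⋂_N (K^×)^N = {1}` for a number field `K` ([AbsTopIII] Rmk. 1.5.3 (i), number-field case;
our proof: finite valuations force such an element and all its roots into `(𝓞 K)ˣ`; by
Dirichlet's unit theorem `(𝓞 K)ˣ / torsion` is a free `ℤ`-module of finite rank, where an
infinitely divisible class vanishes; so the element is a root of unity, divisible inside the finite
group `μ(K)`, hence `1`). [cite: MochizukiAbsTopIII2015, Rmk 1.5.3 (i) p.33] -/
theorem units_eq_one_of_forall_exists_pow (x : Kˣ) (h : ∀ n : ℕ, 0 < n → ∃ y : Kˣ, y ^ n = x) :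
    x = 1 := by
  -- (1) all finite valuations of `x` are `1`, so `x` is a unit `u` of `𝓞 K`
  have hval : ∀ v : HeightOneSpectrum (𝓞 K), v.valuation K (x : K) = 1 := by
    intro v
    refine withZeroMulInt_eq_one_of_forall_exists_pow _
      ((Valuation.ne_zero_iff _).mpr x.ne_zero) fun n hn => ?_
    obtain ⟨y, hy⟩ := h n hn
    exact ⟨v.valuation K (y : K), by rw [← map_pow, ← Units.val_pow_eq_pow_val, hy]⟩
  obtain ⟨u, hu⟩ := exists_unit_of_forall_valuation_eq_one x hval
  have hinj : Function.Injective (algebraMap (𝓞 K) K) := IsFractionRing.injective (𝓞 K) K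
  -- (2) every `n`-th root of `x` is likewise a unit `w` of `𝓞 K` with `w ^ n = u`
  have hroot : ∀ n : ℕ, 0 < n → ∃ w : (𝓞 K)ˣ, w ^ n = u := by
    intro n hn
    obtain ⟨y, hy⟩ := h n hn
    have hyval : ∀ v : HeightOneSpectrum (𝓞 K), v.valuation K (y : K) = 1 := by
      intro v
      refine withZeroMulInt_eq_one_of_pow_eq_one _ hn ?_
      rw [← map_pow, ← Units.val_pow_eq_pow_val, hy, hval v]
    obtain ⟨w, hw⟩ := exists_unit_of_forall_valuation_eq_one y hyval
    refine ⟨w, Units.ext (hinj ?_)⟩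
    rw [Units.val_pow_eq_pow_val, map_pow, hw, hu, ← Units.val_pow_eq_pow_val, hy]
  -- (3) in the free ℤ-module `(𝓞 K)ˣ ⧸ torsion`, the class of `u` is divisible by every `n`
  let π : (𝓞 K)ˣ →* (𝓞 K)ˣ ⧸ torsion K := QuotientGroup.mk' (torsion K)
  have hcls : Additive.ofMul (π u) = 0 := by
    refine eq_zero_of_forall_exists_nsmul (M := Additive ((𝓞 K)ˣ ⧸ torsion K)) _ fun n hn => ?_
    obtain ⟨w, hw⟩ := hroot n hn
    exact ⟨Additive.ofMul (π w), by rw [← ofMul_pow, ← map_pow, hw]⟩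
  have hut : u ∈ torsion K := (QuotientGroup.eq_one_iff u).mp (by simpa [π] using hcls)
  -- (4) a root `w` of order `N = #torsion` is torsion too, so `u = w ^ N = 1`
  obtain ⟨w, hw⟩ := hroot (Nat.card (torsion K)) Nat.card_pos
  have hwt : w ∈ torsion K := by
    have hut' : IsOfFinOrder u := (CommGroup.mem_torsion u).mp hut
    obtain ⟨k, hk, huk⟩ := isOfFinOrder_iff_pow_eq_one.mp hut'
    exact (CommGroup.mem_torsion w).mpr (isOfFinOrder_iff_pow_eq_one.mpr
      ⟨Nat.card (torsion K) * k, Nat.mul_pos Nat.card_pos hk, by rw [pow_mul, hw, huk]⟩)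
  have hwN : w ^ Nat.card (torsion K) = 1 := by
    have := (pow_card_eq_one' : (⟨w, hwt⟩ : torsion K) ^ Nat.card (torsion K) = 1)
    exact congrArg Subtype.val this
  have hu1 : u = 1 := by rw [← hw, hwN]
  apply Units.ext
  rw [← hu, hu1, Units.val_one, map_one, Units.val_one]


/-- Number fields satisfy condition (a) of [AbsTopIII] Def. 1.5 for `𝔾_m`: `⋂_N (K^×)^N = {1}`.
[cite: MochizukiAbsTopIII2015, Rmk 1.5.3 (i) p.33] -/
theorem divisibleElementsTrivial_units_of_numberField (K : Type u) [Field K] [NumberField K] :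
    DivisibleElementsTrivial Kˣ :=
  ⟨fun x hx => units_eq_one_of_forall_exists_pow x hx⟩

/-- Every number field is torally Kummer-faithful ([AbsTopIII] Rmk. 1.5.3 (i), number-field
case; finite extensions of number fields are number fields).
[cite: MochizukiAbsTopIII2015, Rmk 1.5.3 (i) p.33] -/
theorem isTorallyKummerFaithful_of_numberField (k : Type u) [Field k] [NumberField k] :
    IsTorallyKummerFaithful k := by
  refine ⟨inferInstance, fun k' _ _ hfin => ?_⟩
  haveI : Module.Finite k k' := hfin
  haveI : NumberField k' := NumberField.of_module_finite k k'
  exact divisibleElementsTrivial_units_of_numberField k'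

/-- DISCHARGE of the named fact `Rmk_1_5_3_i` of `AbsTopIII/KummerFaithful.lean`.
[cite: MochizukiAbsTopIII2015, Rmk 1.5.3 (i) p.33] -/
theorem Rmk_1_5_3_i_holds : Rmk_1_5_3_i := fun k _ _ => isTorallyKummerFaithful_of_numberField k

end Literature.AnabelianGeometry.AbsoluteAnabelian.AbsTopIII
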